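import Literature.NumberTheory.Transcendental.CalegariDimitrovTangL2Chi3
import Mathlib.NumberTheory.LSeries.DirichletContinuation
import Mathlib.NumberTheory.LegendreSymbol.QuadraticChar.Basic
import Mathlib.Tactic
import HarnessLib

/-!
# `L2chi3` is the Dirichlet `L`-value `L(2, χ₋₃)` (identification with Mathlib's `LFunction`)

Sibling of `CalegariDimitrovTangL2Chi3.lean`, where the real number
`Literature.NumberTheory.Transcendental.L2chi3` is *defined* by the series of
Calegari–Dimitrov–Tang's Theorem 1, `L(2, χ₋₃) = Σ_{n ≥ 0} (1/(3n+1)² − 1/(3n+2)²)`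
(arXiv:2408.15403, p. 3), and whose module docstring leaves "the identification of `L2chi3`
with `LSeries (n ↦ (n/3)) 2` for the quadratic character modulo `3` … to a sibling file (cf.
`CatalanConstantBeta.lean` for `L(2, χ₄)`)". CDT §1.1 (p. 3): "`L(k,χ) = Σ_{n ≥ 1} χ(n)/n^k` for
quadratic characters `χ` … the character `χ = χ₋₃` of smallest possible conductor", and the
abstract: "`L(2,χ₋₃) = 1/1² − 1/2² + 1/4² − 1/5² + 1/7² − 1/8² + …`".

This file proves that identification against Mathlib's own objects. The odd quadratic character
of conductor `3` is Mathlib's `quadraticChar (ZMod 3)` (values `χ(1) = 1`, `χ(2) = −1`,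
`χ(0) = 0`), a `DirichletCharacter ℤ 3 = MulChar (ZMod 3) ℤ`, viewed in `ℂ` through
`MulChar.ringHomComp (Int.castRingHom ℂ)`:

* `LSeries_chi3_two_eq_L2chi3` — the Dirichlet series `Σ_{n ≥ 1} χ₋₃(n) n^{-2}` (Mathlib
  `LSeries`) equals `L2chi3`: split `n = 3k + r`; the terms with `r = 0` vanish, `r = 1` gives
  `1/(3k+1)²`, `r = 2` gives `−1/(3k+2)²` (`L2chi3_eq_sub`);
* `L2chi3_eq_LFunction_chi3_two` — hence `L2chi3 = L(2, χ₋₃)` for Mathlib's analytically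
  continued `DirichletCharacter.LFunction` (`LFunction_eq_LSeries`, as `re 2 > 1`).

No new definitions and no named facts (D-0026): both results are theorems.

## References

* [CalegariDimitrovTang2024] arXiv:2408.15403, Abstract and §1.1, Thm. 1 (p. 3).
-/

noncomputable section

open Complex

namespace Literature.NumberTheory.Transcendental

/-! ### The character `χ₋₃ = quadraticChar (ZMod 3)` on residues -/

/-- `χ₋₃(2) = −1`: `2` is not a square modulo `3`. [folklore] -/
theorem quadraticChar_zmod_three_two : quadraticChar (ZMod 3) 2 = -1 := by
  decide

/-- The residue of `3k + r` modulo `3` is `r`. [folklore] -/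
theorem natCast_three_mul_add_zmod_three (k r : ℕ) :
    ((3 * k + r : ℕ) : ZMod 3) = (r : ZMod 3) := by
  have h3 : ((3 : ℕ) : ZMod 3) = 0 := ZMod.natCast_self 3
  rw [Nat.cast_add, Nat.cast_mul, h3, zero_mul, zero_add]

/-- The `n = 3k` terms of `Σ χ₋₃(n) n^{-2}` vanish. [folklore] -/
theorem LSeries_term_chi3_two_zero (k : ℕ) :
    LSeries.term (fun n : ℕ => ((quadraticChar (ZMod 3) n : ℤ) : ℂ)) 2 (3 * k) = 0 := by
  rcases Nat.eq_zero_or_pos k with rfl | hk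
  · simp
  · rw [LSeries.term_of_ne_zero (by omega : 3 * k ≠ 0)]
    have h0 : quadraticChar (ZMod 3) ((3 * k : ℕ) : ZMod 3) = 0 := by
      have := natCast_three_mul_add_zmod_three k 0
      rw [add_zero] at this
      rw [this, Nat.cast_zero, MulChar.map_zero]
    rw [h0]
    simp

/-- The `n = 3k+1` term of `Σ χ₋₃(n) n^{-2}` is `1/(3k+1)²`. [folklore] -/
theorem LSeries_term_chi3_two_one (k : ℕ) :
    LSeries.term (fun n : ℕ => ((quadraticChar (ZMod 3) n : ℤ) : ℂ)) 2 (3 * k + 1) =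
      1 / ((3 * k + 1 : ℂ)) ^ 2 := by
  rw [LSeries.term_of_ne_zero (by omega : 3 * k + 1 ≠ 0)]
  have h1 : quadraticChar (ZMod 3) ((3 * k + 1 : ℕ) : ZMod 3) = 1 := by
    rw [natCast_three_mul_add_zmod_three k 1, Nat.cast_one, MulChar.map_one]
  rw [h1, Complex.cpow_two]
  push_cast
  ring

/-- The `n = 3k+2` term of `Σ χ₋₃(n) n^{-2}` is `−1/(3k+2)²`. [folklore] -/
theorem LSeries_term_chi3_two_two (k : ℕ) :
    LSeries.term (fun n : ℕ => ((quadraticChar (ZMod 3) n : ℤ) : ℂ)) 2 (3 * k + 2) =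
      -(1 / ((3 * k + 2 : ℂ)) ^ 2) := by
  rw [LSeries.term_of_ne_zero (by omega : 3 * k + 2 ≠ 0)]
  have h2 : quadraticChar (ZMod 3) ((3 * k + 2 : ℕ) : ZMod 3) = -1 := by
    rw [natCast_three_mul_add_zmod_three k 2]
    exact quadraticChar_zmod_three_two
  rw [h2, Complex.cpow_two]
  push_cast
  ring

/-! ### The identification -/

/-- **`L2chi3` is the naive Dirichlet series `Σ_{n ≥ 1} χ₋₃(n)/n²`** (Mathlib `LSeries` of
`quadraticChar (ZMod 3)` at `s = 2`): "`L(2,χ₋₃) = 1/1² − 1/2² + 1/4² − 1/5² + 1/7² − 1/8² + …`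
`= Σ_{n ≥ 0} (1/(3n+1)² − 1/(3n+2)²)`". Proof: reindex the absolutely convergent series along
`n = 3k + r` and sum the three fibers `0`, `Σ 1/(3k+1)²`, `−Σ 1/(3k+2)²` (`L2chi3_eq_sub`).
[cite: CalegariDimitrovTang2024, Abstract and Thm. 1 (p. 3)] -/
theorem LSeries_chi3_two_eq_L2chi3 :
    LSeries (fun n : ℕ => ((quadraticChar (ZMod 3) n : ℤ) : ℂ)) 2 = (L2chi3 : ℂ) := by
  set f : ℕ → ℂ := fun n => LSeries.term (fun n : ℕ => ((quadraticChar (ZMod 3) n : ℤ) : ℂ)) 2 n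
    with hf
  -- absolute convergence at `s = 2`
  have hsum : Summable f := by
    have h := DirichletCharacter.LSeriesSummable_of_one_lt_re
      ((quadraticChar (ZMod 3)).ringHomComp (Int.castRingHom ℂ)) (by norm_num : 1 < (2 : ℂ).re)
    exact h
  -- reindex along `Fin 3 × ℕ ≃ ℕ`, `(r, k) ↦ 3k + r`
  let e : Fin 3 × ℕ ≃ ℕ := (Equiv.prodComm (Fin 3) ℕ).trans (Nat.divModEquiv 3).symm
  have he : ∀ p : Fin 3 × ℕ, e p = p.2 * 3 + (p.1 : ℕ) := fun p => rfl
  have htot : HasSum (fun p : Fin 3 × ℕ => f (3 * p.2 + (p.1 : ℕ))) (LSeries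
      (fun n : ℕ => ((quadraticChar (ZMod 3) n : ℤ) : ℂ)) 2) := by
    have h := (e.hasSum_iff (f := f)).mpr hsum.hasSum
    refine (h.congr_fun ?_)
    intro p
    simp only [Function.comp_apply, he]
    congr 1
    ring
  -- the three fibers
  let T : Fin 3 → ℂ := ![0, ((∑' k : ℕ, 1 / (3 * (k : ℝ) + 1) ^ 2 : ℝ) : ℂ),
    -(((∑' k : ℕ, 1 / (3 * (k : ℝ) + 2) ^ 2 : ℝ) : ℂ))]
  have hfib : ∀ r : Fin 3, HasSum (fun k : ℕ => f (3 * k + (r : ℕ))) (T r) := by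
    intro r
    fin_cases r
    · change HasSum (fun k : ℕ => f (3 * k + 0)) 0
      simp only [hf, add_zero, LSeries_term_chi3_two_zero]
      exact hasSum_zero
    · change HasSum (fun k : ℕ => f (3 * k + 1))
        (((∑' k : ℕ, 1 / (3 * (k : ℝ) + 1) ^ 2 : ℝ)) : ℂ)
      have h := (Complex.hasSum_ofReal (L := SummationFilter.unconditional ℕ)).mpr
        summable_one_div_three_mul_add_one_sq.hasSum
      simp only [hf, LSeries_term_chi3_two_one]
      refine h.congr_fun fun k => ?_
      push_cast
      ring
    · change HasSum (fun k : ℕ => f (3 * k + 2))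
        (-(((∑' k : ℕ, 1 / (3 * (k : ℝ) + 2) ^ 2 : ℝ)) : ℂ))
      have h := ((Complex.hasSum_ofReal (L := SummationFilter.unconditional ℕ)).mpr
        summable_one_div_three_mul_add_two_sq.hasSum).neg
      simp only [hf, LSeries_term_chi3_two_two]
      refine h.congr_fun fun k => ?_
      push_cast
      ring
  have hsum3 : HasSum T (LSeries (fun n : ℕ => ((quadraticChar (ZMod 3) n : ℤ) : ℂ)) 2) :=
    htot.prod_fiberwise hfib
  have huniq := hsum3.unique (hasSum_fintype T)
  rw [Fin.sum_univ_three] at huniq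
  rw [huniq, L2chi3_eq_sub]
  simp only [T, Matrix.cons_val_zero, Matrix.cons_val_one, Matrix.cons_val]
  push_cast
  ring

/-- **`L2chi3 = L(2, χ₋₃)`** for Mathlib's analytically continued `DirichletCharacter.LFunction`
of the odd quadratic character of conductor `3` (`quadraticChar (ZMod 3)`, viewed in `ℂ`): the
value at `s = 2` of "the Dirichlet `L`-value `L(k,χ) = Σ χ(n)/n^k` … `k = 2` and the character
`χ = χ₋₃` of smallest possible conductor". [cite: CalegariDimitrovTang2024, §1.1 and Thm. 1 (p. 3)] -/
theorem L2chi3_eq_LFunction_chi3_two :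
    (L2chi3 : ℂ) =
      DirichletCharacter.LFunction ((quadraticChar (ZMod 3)).ringHomComp (Int.castRingHom ℂ) :
        DirichletCharacter ℂ 3) 2 := by
  rw [DirichletCharacter.LFunction_eq_LSeries _ (by norm_num : 1 < (2 : ℂ).re),
    ← LSeries_chi3_two_eq_L2chi3]
  rfl

end Literature.NumberTheory.Transcendental
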